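import Literature.RingTheory.MvPolynomial.HomogeneousDimension
import Literature.RingTheory.MvPolynomial.HilbertPolynomialExists
import Literature.RingTheory.KrullDimension.AffineDimension
import HarnessLib

/-!
# Bounds for the Hilbert function of a homogeneous ideal: `binom(t+b, b) ≤ H(I; t) ≤ C (t+1)^b`

Topic: `Literature/RingTheory/MvPolynomial`. For a homogeneous ideal `I ⊆ S = K[X_0, …, X_{m-1}]`
over an infinite field with `dim S/I = b + 1` (the projective zero set of `I` has dimension `b`),
the two inequalities behind "the degree of the Hilbert polynomial is the dimension"
(Hartshorne, *Algebraic Geometry*, I.7.5):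

* **`hilbert_le_mul_pow`** — `H(I; t) ≤ C (t+1)^b` when `dim S/I ≤ b + 1` (induction on `b`,
  cutting by a general linear form `ℓ`: `H(I; t+1) ≤ H(I; t) + H(I + (ℓ); t+1)` from
  `HomogeneousHilbertFunction.lean`, the dimension drop and the Artinian vanishing from
  `HomogeneousDimension.lean`); `exists_linearForm_ringKrullDim_sup_lt` is the choice of `ℓ`;
* **`choose_le_hilbert_of_isPrime`** — `binom(t + b, b) ≤ H(𝔭; t)` for a prime `𝔭` with
  `dim S/𝔭 = b + 1`: `b + 1` of the coordinate functions are algebraically independent modulo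
  `𝔭` (`exists_algebraicIndependent_X_mod`, from `dim = trdeg`,
  `Literature.RingTheory.KrullDimension.ringKrullDim_eq_card_of_isTranscendenceBasis`), so the
  degree-`t` monomials in them are linearly independent modulo `𝔭_t`.

The conclusion for the Hilbert POLYNOMIAL is drawn in `HilbertPolynomialDegree.lean`.

## References

* R. Hartshorne, *Algebraic Geometry*, GTM 52 (1977), Ch. I, Thm. 7.5. [Hartshorne1977]
-/

noncomputable section

open Module

attribute [local instance] MvPolynomial.gradedAlgebra

namespace Literature.RingTheory.MvPolynomial

variable {K : Type*} [Field K] {m : ℕ}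

local notation "hilb(" I ", " t ")" =>
  (Module.finrank K (MvPolynomial.homogeneousSubmodule (Fin m) K t) -
    Module.finrank K (idealDegree I t))

/-! ## The upper bound `H(I; t) ≤ C (t+1)^{dim - 1}` -/

/-- An eventually non-increasing-by-zero function: if `H(I; t+1) ≤ H(I; t)` for `t ≥ t₀` then
`H(I; ·)` is bounded. (Arithmetic helper.) [folklore] -/
theorem exists_bound_of_succ_le {f : ℕ → ℕ} {t₀ : ℕ} (h : ∀ t, t₀ ≤ t → f (t + 1) ≤ f t) :
    ∃ C, ∀ t, f t ≤ C := by
  refine ⟨(Finset.range (t₀ + 1)).sup f, fun t => ?_⟩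
  induction t with
  | zero => exact Finset.le_sup (f := f) (by simp)
  | succ t ih =>
    by_cases ht : t₀ ≤ t
    · exact (h t ht).trans ih
    · exact Finset.le_sup (f := f) (by simp; omega)

/-- Arithmetic helper for the induction: `f(t+1) ≤ f(t) + C (t+2)^b` forces
`f(t) ≤ (f 0 + C) (t+1)^{b+1}`. [folklore] -/
theorem le_mul_pow_succ_of_succ_le {f : ℕ → ℕ} {C b : ℕ}
    (h : ∀ t, f (t + 1) ≤ f t + C * (t + 2) ^ b) (t : ℕ) :
    f t ≤ (f 0 + C) * (t + 1) ^ (b + 1) := by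
  induction t with
  | zero => simp
  | succ t ih =>
    have h1 := h t
    have h2 : (t + 1) ^ b ≤ (t + 2) ^ b := Nat.pow_le_pow_left (by omega) b
    have h3 : (f 0 + C) * (t + 1) ^ (b + 1) + C * (t + 2) ^ b ≤
        (f 0 + C) * (t + 1 + 1) ^ (b + 1) := by
      have hkey : (t + 1) ^ (b + 1) + (t + 2) ^ b ≤ (t + 2) ^ (b + 1) := by
        have e1 : (t + 2) ^ (b + 1) = (t + 2) ^ b * (t + 1) + (t + 2) ^ b := by ring
        have e2 : (t + 1) ^ (b + 1) = (t + 1) ^ b * (t + 1) := by ring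
        rw [e1, e2]
        have := Nat.mul_le_mul_right (t + 1) h2
        omega
      have h4 : (f 0 + C) * ((t + 1) ^ (b + 1) + (t + 2) ^ b) ≤ (f 0 + C) * (t + 2) ^ (b + 1) :=
        Nat.mul_le_mul_left _ hkey
      have h5 : C * (t + 2) ^ b ≤ (f 0 + C) * (t + 2) ^ b := Nat.mul_le_mul_right _ (by omega)
      rw [mul_add] at h4
      rw [show t + 1 + 1 = t + 2 from rfl]
      omega
    calc f (t + 1) ≤ f t + C * (t + 2) ^ b := h1
      _ ≤ (f 0 + C) * (t + 1) ^ (b + 1) + C * (t + 2) ^ b := by omega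
      _ ≤ (f 0 + C) * (t + 1 + 1) ^ (b + 1) := h3

/-- `span {ℓ}` is homogeneous for a homogeneous `ℓ`. [folklore] -/
theorem isHomogeneous_span_singleton {ℓ : MvPolynomial (Fin m) K} {q : ℕ}
    (hℓ : ℓ.IsHomogeneous q) :
    (Ideal.span {ℓ}).IsHomogeneous (MvPolynomial.homogeneousSubmodule (Fin m) K) :=
  Ideal.homogeneous_span _ _ fun x hx => ⟨q, by rw [Set.mem_singleton_iff.mp hx]; exact hℓ⟩

/-- **The step of the upper bound**: for a homogeneous `I` with `dim S/I = n ≥ 1` there is a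
non-zero linear form `ℓ` with `dim S/(I + (ℓ)) < n` (avoid the minimal primes of `I` of
dimension `n`; they miss a variable since `n ≠ 0`). [folklore] -/
theorem exists_linearForm_ringKrullDim_sup_lt [Infinite K] {I : Ideal (MvPolynomial (Fin m) K)}
    {n : ℕ} (hn : 1 ≤ n) (hdim : ringKrullDim (MvPolynomial (Fin m) K ⧸ I) = n) :
    ∃ ℓ : MvPolynomial (Fin m) K, ℓ.IsHomogeneous 1 ∧ ℓ ≠ 0 ∧
      ringKrullDim (MvPolynomial (Fin m) K ⧸ (I ⊔ Ideal.span {ℓ})) < n := by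
  classical
  have hI : I ≠ ⊤ := by
    rintro rfl
    rw [ringKrullDim_eq_bot_of_subsingleton] at hdim
    exact WithBot.bot_ne_coe hdim
  obtain ⟨n', hn', hn'm⟩ := exists_nat_ringKrullDim_quotient_eq (K := K) hI
  rw [hdim] at hn'
  have hnn' : n = n' := by exact_mod_cast hn'
  subst hnn'
  have hm : 0 < m := by omega
  -- the minimal primes of `I` of dimension `n`
  let P : Finset (Ideal (MvPolynomial (Fin m) K)) :=
    (Ideal.finite_minimalPrimes_of_isNoetherianRing _ I).toFinset.filter
      fun 𝔭 => ringKrullDim (MvPolynomial (Fin m) K ⧸ 𝔭) = n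
  have hmemP : ∀ 𝔭, 𝔭 ∈ P ↔ 𝔭 ∈ I.minimalPrimes ∧ ringKrullDim (MvPolynomial (Fin m) K ⧸ 𝔭) = n :=
    fun 𝔭 => by simp only [P, Finset.mem_filter, Set.Finite.mem_toFinset]
  have hP : ∀ 𝔭 ∈ P, ∃ i, (MvPolynomial.X i : MvPolynomial (Fin m) K) ∉ 𝔭 := by
    intro 𝔭 h𝔭
    rw [hmemP] at h𝔭
    haveI : 𝔭.IsPrime := h𝔭.1.1.1
    refine exists_X_notMem_of_ringKrullDim_ne_zero ?_
    rw [h𝔭.2]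
    exact_mod_cast (show n ≠ 0 by omega)
  obtain ⟨ℓ, hℓ1, hℓ0, hℓP⟩ := exists_linearForm_forall_notMem hm P hP
  refine ⟨ℓ, hℓ1, hℓ0, ringKrullDim_quotient_sup_span_lt hdim.le ?_⟩
  intro 𝔭 h𝔭 hℓ𝔭
  have hne : ringKrullDim (MvPolynomial (Fin m) K ⧸ 𝔭) ≠ n := fun heq =>
    hℓP 𝔭 ((hmemP 𝔭).mpr ⟨h𝔭, heq⟩) hℓ𝔭
  have hle : ringKrullDim (MvPolynomial (Fin m) K ⧸ 𝔭) ≤ n := by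
    rw [← hdim]
    exact ringKrullDim_le_of_surjective (Ideal.Quotient.factor h𝔭.1.2)
      (Ideal.Quotient.factor_surjective h𝔭.1.2)
  exact lt_of_le_of_ne hle hne

/-- `< n + 1` is `≤ n` for Krull dimensions. [folklore] -/
theorem ringKrullDim_le_of_lt_succ {R : Type*} [CommRing R] {n : ℕ}
    (h : ringKrullDim R < (n + 1 : ℕ)) : ringKrullDim R ≤ n := by
  generalize hv : ringKrullDim R = v at h
  induction v using WithBot.recBotCoe with
  | bot => exact bot_le
  | coe v =>
    induction v using ENat.recTopCoe with
    | top => exact absurd h (not_lt.mpr le_top)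
    | coe k =>
      have : k < n + 1 := by exact_mod_cast h
      exact_mod_cast Nat.lt_succ_iff.mp this

/-- **Upper bound for the Hilbert function** (Hartshorne I.7.5, the inequality `deg P_I ≤ dim`):
for a homogeneous ideal `I ⊆ K[X_0, …, X_{m-1}]` (`K` infinite) with `dim S/I ≤ b + 1` there is `C`
with `H(I; t) ≤ C (t+1)^b` for all `t`. Induction on `b`: cut by a general linear form `ℓ`
(`H(I; t+1) ≤ H(I; t) + H(I + (ℓ); t+1)`), the Artinian case giving eventual vanishing.
[cite: Hartshorne1977, Ch. I Thm. 7.5] -/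
theorem hilbert_le_mul_pow [Infinite K] (b : ℕ) :
    ∀ (I : Ideal (MvPolynomial (Fin m) K)),
      I.IsHomogeneous (MvPolynomial.homogeneousSubmodule (Fin m) K) →
      ringKrullDim (MvPolynomial (Fin m) K ⧸ I) ≤ (b + 1 : ℕ) →
      ∃ C : ℕ, ∀ t, hilb(I, t) ≤ C * (t + 1) ^ b := by
  induction b with
  | zero =>
    intro I hI hdim
    -- either `dim ≤ 0` (Artinian: eventually `0`), or `dim = 1`: cut by `ℓ` with `dim ≤ 0`.
    suffices h : ∃ t₀, ∀ t, t₀ ≤ t → hilb(I, t + 1) ≤ hilb(I, t) by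
      obtain ⟨t₀, ht₀⟩ := h
      obtain ⟨C, hC⟩ := exists_bound_of_succ_le (f := fun t => hilb(I, t)) ht₀
      exact ⟨C, fun t => by simpa using hC t⟩
    by_cases h0 : ringKrullDim (MvPolynomial (Fin m) K ⧸ I) ≤ 0
    · obtain ⟨t₀, ht₀⟩ := hilbert_eq_zero_of_X_pow_mem
        (exists_X_pow_mem_of_ringKrullDim_le_zero hI h0)
      exact ⟨t₀, fun t ht => by rw [ht₀ (t + 1) (by omega)]; exact Nat.zero_le _⟩
    · have h1 : ringKrullDim (MvPolynomial (Fin m) K ⧸ I) = (1 : ℕ) := by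
        refine le_antisymm hdim ?_
        have hI' : I ≠ ⊤ := by
          rintro rfl
          rw [ringKrullDim_eq_bot_of_subsingleton] at h0
          exact h0 bot_le
        obtain ⟨n, hn, -⟩ := exists_nat_ringKrullDim_quotient_eq (K := K) hI'
        rw [hn] at h0 ⊢
        have : ¬ n ≤ 0 := fun h => h0 (by exact_mod_cast h)
        exact_mod_cast (show 1 ≤ n by omega)
      obtain ⟨ℓ, hℓ1, hℓ0, hlt⟩ := exists_linearForm_ringKrullDim_sup_lt le_rfl h1
      have hJ : (I ⊔ Ideal.span {ℓ}).IsHomogeneous (MvPolynomial.homogeneousSubmodule (Fin m) K) :=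
        hI.sup (isHomogeneous_span_singleton hℓ1)
      have hJ0 : ringKrullDim (MvPolynomial (Fin m) K ⧸ (I ⊔ Ideal.span {ℓ})) ≤ 0 :=
        ringKrullDim_le_of_lt_succ (n := 0) (by simpa using hlt)
      obtain ⟨t₀, ht₀⟩ := hilbert_eq_zero_of_X_pow_mem
        (exists_X_pow_mem_of_ringKrullDim_le_zero hJ hJ0)
      refine ⟨t₀, fun t ht => ?_⟩
      have := hilbert_add_le_hilbert_add_hilbert_sup_span hI hℓ0 hℓ1 t
      rw [ht₀ (t + 1) (by omega), add_zero] at this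
      exact this
  | succ b ih =>
    intro I hI hdim
    by_cases hle : ringKrullDim (MvPolynomial (Fin m) K ⧸ I) ≤ (b + 1 : ℕ)
    · obtain ⟨C, hC⟩ := ih I hI hle
      refine ⟨C, fun t => (hC t).trans ?_⟩
      exact Nat.mul_le_mul_left C (Nat.pow_le_pow_right (by omega) (by omega))
    · have heq : ringKrullDim (MvPolynomial (Fin m) K ⧸ I) = (b + 1 + 1 : ℕ) := by
        refine le_antisymm hdim ?_
        have hI' : I ≠ ⊤ := by
          rintro rfl
          rw [ringKrullDim_eq_bot_of_subsingleton] at hle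
          exact hle bot_le
        obtain ⟨n, hn, -⟩ := exists_nat_ringKrullDim_quotient_eq (K := K) hI'
        rw [hn] at hle ⊢
        have : ¬ n ≤ b + 1 := fun h => hle (by exact_mod_cast h)
        exact_mod_cast (show b + 1 + 1 ≤ n by omega)
      obtain ⟨ℓ, hℓ1, hℓ0, hlt⟩ := exists_linearForm_ringKrullDim_sup_lt (by omega) heq
      have hJ : (I ⊔ Ideal.span {ℓ}).IsHomogeneous (MvPolynomial.homogeneousSubmodule (Fin m) K) :=
        hI.sup (isHomogeneous_span_singleton hℓ1)
      obtain ⟨C, hC⟩ := ih _ hJ (ringKrullDim_le_of_lt_succ hlt)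
      refine ⟨hilb(I, 0) + C, fun t =>
        le_mul_pow_succ_of_succ_le (f := fun t => hilb(I, t)) (C := C) (b := b) (fun s => ?_) t⟩
      have h1 := hilbert_add_le_hilbert_add_hilbert_sup_span hI hℓ0 hℓ1 s
      have h2 := hC (s + 1)
      calc hilb(I, s + 1) ≤ hilb(I, s) + hilb(I ⊔ Ideal.span {ℓ}, s + 1) := h1
        _ ≤ hilb(I, s) + C * (s + 2) ^ b := by
            have : (s + 1 + 1) = s + 2 := by ring
            rw [this] at h2
            exact Nat.add_le_add_left h2 _

/-! ## The lower bound `binom(t + b, b) ≤ H(𝔭; t)` for primes of dimension `b + 1` -/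

/-- **Algebraically independent coordinates modulo a prime**: for a prime `𝔭` of
`S = K[X_0, …, X_{m-1}]` with `dim S/𝔭 = b + 1` there is an injective `v : Fin (b+1) → Fin m`
such that the classes of `X_{v 0}, …, X_{v b}` are algebraically independent in `S/𝔭`
(a transcendence basis extracted from the generators; `dim = trdeg` for affine domains).
[folklore] -/
theorem exists_algebraicIndependent_X_mod {𝔭 : Ideal (MvPolynomial (Fin m) K)} [𝔭.IsPrime]
    {b : ℕ} (hdim : ringKrullDim (MvPolynomial (Fin m) K ⧸ 𝔭) = (b + 1 : ℕ)) :
    ∃ v : Fin (b + 1) → Fin m, Function.Injective v ∧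
      AlgebraicIndependent K (fun i => Ideal.Quotient.mk 𝔭 (MvPolynomial.X (v i))) := by
  classical
  set A := MvPolynomial (Fin m) K ⧸ 𝔭 with hA
  let x : Fin m → A := fun i => Ideal.Quotient.mk 𝔭 (MvPolynomial.X i)
  have hadj : Algebra.adjoin K (Set.range x) = ⊤ := by
    have : Set.range x = (Ideal.Quotient.mkₐ K 𝔭) '' Set.range (MvPolynomial.X : Fin m → _) := by
      rw [← Set.range_comp]; rfl
    rw [this, ← AlgHom.map_adjoin, MvPolynomial.adjoin_range_X, Algebra.map_top,
      AlgHom.range_eq_top]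
    exact Ideal.Quotient.mkₐ_surjective K 𝔭
  haveI : Algebra.IsAlgebraic (Algebra.adjoin K (Set.range x)) A := by
    rw [hadj]
    constructor
    intro a
    exact isAlgebraic_algebraMap (⟨a, Algebra.mem_top⟩ : (⊤ : Subalgebra K A))
  obtain ⟨u, hu, hbasis⟩ := exists_isTranscendenceBasis_subset (R := K) (Set.range x)
  have hfin : u.Finite := (Set.finite_range x).subset hu
  letI : Fintype u := hfin.fintype
  haveI : Algebra.FiniteType K A :=
    Algebra.FiniteType.of_surjective (Ideal.Quotient.mkₐ K 𝔭) (Ideal.Quotient.mkₐ_surjective K 𝔭)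
  have hcard : ringKrullDim A = Fintype.card u :=
    Literature.RingTheory.KrullDimension.ringKrullDim_eq_card_of_isTranscendenceBasis K A hbasis
  rw [hdim] at hcard
  have hcard' : Fintype.card u = b + 1 := by exact_mod_cast hcard.symm
  -- index the basis by `Fin (b+1)` and choose variables mapping to it
  let e : Fin (b + 1) ≃ u := (Fintype.equivFinOfCardEq hcard').symm
  have hsec : ∀ y : u, ∃ i : Fin m, x i = y := fun y => by
    obtain ⟨i, hi⟩ := hu y.2
    exact ⟨i, hi⟩
  choose g hg using hsec
  refine ⟨fun j => g (e j), ?_, ?_⟩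
  · intro j j' h
    apply e.injective
    apply Subtype.ext
    rw [← hg (e j), ← hg (e j')]
    exact congrArg x h
  · have : (fun j => Ideal.Quotient.mk 𝔭 (MvPolynomial.X (g (e j)))) = ((↑) : u → A) ∘ e := by
      funext j
      exact hg (e j)
    rw [this]
    exact hbasis.1.comp _ e.injective

/-- **Lower bound for the Hilbert function of a prime** (Hartshorne I.7.5, `deg P ≥ dim`): if
`dim S/𝔭 = b + 1` then `binom(t + b, b) ≤ H(𝔭; t)` for every `t`: the degree-`t` monomials in
`b + 1` algebraically independent coordinates are linearly independent modulo `𝔭_t`.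
[cite: Hartshorne1977, Ch. I Thm. 7.5] -/
theorem choose_le_hilbert_of_isPrime {𝔭 : Ideal (MvPolynomial (Fin m) K)} [𝔭.IsPrime]
    {b : ℕ} (hdim : ringKrullDim (MvPolynomial (Fin m) K ⧸ 𝔭) = (b + 1 : ℕ)) (t : ℕ) :
    (t + b).choose b ≤ hilb(𝔭, t) := by
  classical
  obtain ⟨v, hv, hind⟩ := exists_algebraicIndependent_X_mod hdim
  -- the degree-`t` forms in the variables `v`
  let φ : MvPolynomial (Fin (b + 1)) K →ₐ[K] MvPolynomial (Fin m) K := MvPolynomial.rename v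
  let M : Submodule K (MvPolynomial (Fin m) K) :=
    (MvPolynomial.homogeneousSubmodule (Fin (b + 1)) K t).map φ.toLinearMap
  have hMle : M ≤ MvPolynomial.homogeneousSubmodule (Fin m) K t := by
    rintro _ ⟨g, hg, rfl⟩
    exact (MvPolynomial.IsHomogeneous.rename_isHomogeneous (f := v) hg :)
  have hMinf : M ⊓ idealDegree 𝔭 t = ⊥ := by
    rw [eq_bot_iff]
    rintro f ⟨⟨g, hg, rfl⟩, hf𝔭, -⟩
    have hcomp : Ideal.Quotient.mk 𝔭 (φ g) =
        MvPolynomial.aeval (fun i => Ideal.Quotient.mk 𝔭 (MvPolynomial.X (v i))) g := by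
      change ((Ideal.Quotient.mkₐ K 𝔭).comp φ) g = _
      congr 1
      apply MvPolynomial.algHom_ext
      intro i
      simp [φ]
    have h0 : MvPolynomial.aeval (fun i => Ideal.Quotient.mk 𝔭 (MvPolynomial.X (v i))) g = 0 := by
      rw [← hcomp, Ideal.Quotient.eq_zero_iff_mem]
      exact hf𝔭
    have hg0 : g = 0 := hind (by rw [h0, map_zero])
    simp [hg0]
  haveI : Module.Finite K (MvPolynomial.homogeneousSubmodule (Fin m) K t) :=
    finite_homogeneousSubmodule t
  haveI : Module.Finite K (MvPolynomial.homogeneousSubmodule (Fin (b + 1)) K t) :=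
    finite_homogeneousSubmodule t
  have hM : finrank K M = (t + b).choose b := by
    rw [LinearEquiv.finrank_eq (Submodule.equivMapOfInjective φ.toLinearMap
      (MvPolynomial.rename_injective v hv) _).symm,
      Literature.RingTheory.HilbertSamuel.finrank_homogeneousSubmodule_fin,
      show t + (b + 1) - 1 = t + b by omega, Nat.choose_symm_add]
  have h1 := Submodule.finrank_sup_add_finrank_inf_eq M (idealDegree 𝔭 t)
  rw [hMinf, finrank_bot, add_zero] at h1
  have h2 : finrank K ↥(M ⊔ idealDegree 𝔭 t) ≤
      finrank K (MvPolynomial.homogeneousSubmodule (Fin m) K t) :=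
    Submodule.finrank_mono (sup_le hMle (idealDegree_le_homogeneousSubmodule 𝔭 t))
  have h3 := finrank_idealDegree_le 𝔭 t
  omega

end Literature.RingTheory.MvPolynomial

end
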